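import Mathlib
import HarnessLib
import Summits.Ventures.LatticeQCDFlow.Exactness.SphereLuscherTrivializationMeasure

/-!
# The converse of Lüscher's criterion on the lattice of site spheres: a flow that intertwines the tilted family must solve the flow equation — `(d/ds)⟨H∘Φ_{s→c}⟩_s = 0` for every `C¹` observable forces `𝓛_sG_s − S` to be constant on `Ω`

HONEST FRAMING: exact (Metropolis-corrected) sampling algorithms for lattice gauge theory;
figures of merit are autocorrelation/cost numbers at stated couplings and volumes; no
continuum-physics claim.

Venture `LatticeQCDFlow` (cell pub-lqcd), topic `Exactness`; FANOUT row 7 (`s0-cpn-null`).  NEW WORK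
of the cell over the tree's `Exactness/SphereLuscherTrivializationMeasure.lean` (this leg:
probability measures on `Ω = S(E)^Λ` are determined by the `C¹` ambient functionals),
`Exactness/SphereLuscherTrivialization.lean` (this leg: the time-dependent covariance law),
`Exactness/SphereLuscherFiniteTimeUniqueness.lean` (GEN-12: `π̄` charges every open set of `Ω`) and
Mathlib (`Measure.tilted`, `withDensity_eq_iff_of_sigmaFinite`, `Continuous.ae_eq_iff_eq`);
nothing is cited as a fact.  Printed counterpart, NAMED ONLY: M. Lüscher, Commun. Math. Phys. 293
(2010) 899, §3.2: the flow equation (3.9) is derived there as the CONDITION for the flow to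
trivialize; this file types the necessity on the lattice of site spheres.

* §1 **A VANISHING TILTED COVARIANCE AGAINST EVERY `C¹` TEST FUNCTIONAL FORCES A CONSTANT**
  (**`eq_of_forall_tiltedCov_eq_zero`**): if `R` is continuous on `Ω` and
  `Cov_s(K, R) = ⟨KR⟩_s − ⟨K⟩_s⟨R⟩_s = 0` for every `C¹` functional `K` of the ambient space, then `R`
  is constant on `Ω` — perturb the tilted probability measure `e^{−sS}π̄/Z_s` by the bounded density
  `1 + ε(R − ⟨R⟩_s)`: same mass, same `C¹` integrals, hence the same measure, hence the same density
  everywhere (continuity, full support).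
* §2 **THE FLOW EQUATION IS NECESSARY** (**`sphereLuscherL_sub_eq_of_forall_hasDerivAt_zero`**):
  for a jointly `C²` generator family `G` with evolution maps `Φ = sphereTDFlow hG T`, a `C¹` action
  `S` and `|s₀| ≤ |T| + 1`: if `s ↦ ⟨H∘Φ_{s→c}⟩_s` is stationary at `s₀` for EVERY `C¹` observable `H`,
  then `𝓛_{s₀}G_{s₀} − S` is constant on `Ω` (the covariance law with `H = K∘Φ_{c→s₀}`, which makes
  `H∘Φ_{s₀→c} = K` by Chapman–Kolmogorov); with `Exactness/SphereLuscherTrivialization.lean` this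
  makes Lüscher's flow equation on `[0, c]` EQUIVALENT to the stationarity of all tilted means of
  transported observables (**`sphereLuscherL_sub_eq_of_forall_hasDerivAt_zero_Icc`**).

NOT CLAIMED: anything for generators that are not jointly `C²`; the Jacobian; existence of
solutions; anything quantitative.
-/

noncomputable section

namespace Summit.Ventures.LatticeQCDFlow.Exactness

open Function Set Metric MeasureTheory NormedSpace InnerProductSpace
open scoped RealInnerProductSpace Topology ENNReal

variable {Λ : Type*} {E : Type*} [NormedAddCommGroup E] [InnerProductSpace ℝ E]
  [FiniteDimensional ℝ E] [Fintype Λ] [DecidableEq Λ] [MeasurableSpace E] [BorelSpace E]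
  [Nontrivial E]

/-! ## §1 A vanishing tilted covariance against every `C¹` functional forces a constant -/

section Cov

omit [DecidableEq Λ] in
/-- The a-priori product measure charges every open subset of `Ω`. -/
theorem isOpenPosMeasure_spherePi :
    (Measure.pi (fun _ : Λ => uniformSphere (volume : Measure E))).IsOpenPosMeasure := by
  haveI : (uniformSphere (volume : Measure E)).IsOpenPosMeasure := by
    rw [uniformSphere]
    exact Measure.isOpenPosMeasure_smul _ (ENNReal.inv_ne_zero.2 (measure_ne_top _ _))
  exact Measure.pi.isOpenPosMeasure _

omit [DecidableEq Λ] in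
/-- **A vanishing tilted covariance against every `C¹` ambient functional forces a constant.**  Let
`S` be continuous, `s` real, `R` continuous on `Ω`.  If
`∫e^{−sS}K R dπ̄/Z − (∫e^{−sS}K dπ̄/Z)·(∫e^{−sS}R dπ̄/Z) = 0` for every `C¹` functional `K` of the
ambient space `Λ → E` (`Z = ∫e^{−sS}dπ̄`), then `R` is constant on `Ω`. -/
theorem eq_of_forall_tiltedCov_eq_zero {S : (Λ → E) → ℝ} (hS : Continuous S) (s : ℝ)
    {R : (Λ → sphere (0 : E) 1) → ℝ} (hR : Continuous R)
    (h : ∀ K : (Λ → E) → ℝ, ContDiff ℝ 1 K →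
      (∫ ω, Real.exp (-(s * S (fun m => ((ω : Λ → sphere (0 : E) 1) m : E)))) *
          K (fun m => (ω m : E)) * R ω ∂Measure.pi (fun _ : Λ => uniformSphere (volume : Measure E))) /
          (∫ ω, Real.exp (-(s * S (fun m => ((ω : Λ → sphere (0 : E) 1) m : E))))
            ∂Measure.pi (fun _ : Λ => uniformSphere (volume : Measure E))) -
        (∫ ω, Real.exp (-(s * S (fun m => ((ω : Λ → sphere (0 : E) 1) m : E)))) *
            K (fun m => (ω m : E)) ∂Measure.pi (fun _ : Λ => uniformSphere (volume : Measure E))) /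
          (∫ ω, Real.exp (-(s * S (fun m => ((ω : Λ → sphere (0 : E) 1) m : E))))
            ∂Measure.pi (fun _ : Λ => uniformSphere (volume : Measure E))) *
          ((∫ ω, Real.exp (-(s * S (fun m => ((ω : Λ → sphere (0 : E) 1) m : E)))) * R ω
              ∂Measure.pi (fun _ : Λ => uniformSphere (volume : Measure E))) /
            ∫ ω, Real.exp (-(s * S (fun m => ((ω : Λ → sphere (0 : E) 1) m : E))))
              ∂Measure.pi (fun _ : Λ => uniformSphere (volume : Measure E))) = 0)
    (ω ω' : Λ → sphere (0 : E) 1) : R ω = R ω' := by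
  -- abbreviations
  set μ : Measure (Λ → sphere (0 : E) 1) := Measure.pi (fun _ : Λ => uniformSphere (volume : Measure E))
    with hμ
  set w : (Λ → sphere (0 : E) 1) → ℝ := fun ω => Real.exp (-(s * S (fun m => (ω m : E)))) with hw
  set Z : ℝ := ∫ ω, w ω ∂μ with hZdef
  set Rbar : ℝ := (∫ ω, w ω * R ω ∂μ) / Z with hRbar
  have hwc : Continuous w := continuous_exp_neg_mul_sphereConfig hS s
  have hwpos : ∀ ω, 0 < w ω := fun ω => Real.exp_pos _
  have hZ : 0 < Z := integral_exp_neg_mul_pos (Λ := Λ) (E := E) hS s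
  have hiw : Integrable w μ := integrable_pi_of_continuous _ hwc
  -- step 1: `∫ w K (R − Rbar) dμ = 0` for every `C¹` K
  have h1 : ∀ K : (Λ → E) → ℝ, ContDiff ℝ 1 K →
      ∫ ω, w ω * K (fun m => (ω m : E)) * (R ω - Rbar) ∂μ = 0 := by
    intro K hK
    have hKc : Continuous fun ω : Λ → sphere (0 : E) 1 => K (fun m => (ω m : E)) :=
      hK.continuous.comp continuous_sphereConfig
    have hiKR : Integrable (fun ω => w ω * K (fun m => (ω m : E)) * R ω) μ :=
      integrable_pi_of_continuous _ ((hwc.mul hKc).mul hR)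
    have hiK : Integrable (fun ω => w ω * K (fun m => (ω m : E))) μ :=
      integrable_pi_of_continuous _ (hwc.mul hKc)
    have e1 : ∫ ω, w ω * K (fun m => (ω m : E)) * (R ω - Rbar) ∂μ =
        (∫ ω, w ω * K (fun m => (ω m : E)) * R ω ∂μ) - Rbar * ∫ ω, w ω * K (fun m => (ω m : E)) ∂μ := by
      rw [← integral_const_mul, ← integral_sub hiKR (hiK.const_mul Rbar)]
      refine integral_congr_ae (ae_of_all _ fun ω => ?_)
      ring
    have h0 := h K hK
    rw [sub_eq_zero, div_eq_iff hZ.ne'] at h0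
    rw [e1, h0, hRbar]
    field_simp
    ring
  -- step 2: a bound on `R − Rbar` and a small `ε`
  obtain ⟨B, hB⟩ : ∃ B : ℝ, ∀ ω, |R ω - Rbar| ≤ B := by
    obtain ⟨B, hB⟩ := isCompact_univ.exists_bound_of_continuousOn
      ((hR.sub continuous_const).continuousOn (s := univ))
    exact ⟨B, fun ω => by simpa [Real.norm_eq_abs] using hB ω (mem_univ ω)⟩
  set ε : ℝ := 1 / (2 * (|B| + 1)) with hε
  have hεpos : 0 < ε := by rw [hε]; positivity
  have hpos : ∀ ω, 0 < 1 + ε * (R ω - Rbar) := fun ω => by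
    have h1' : |ε * (R ω - Rbar)| ≤ 1 / 2 := by
      rw [abs_mul, abs_of_pos hεpos, hε]
      have hb : |R ω - Rbar| ≤ |B| := (hB ω).trans (le_abs_self B)
      have hB1 : 0 < |B| + 1 := by positivity
      calc 1 / (2 * (|B| + 1)) * |R ω - Rbar| ≤ 1 / (2 * (|B| + 1)) * (|B| + 1) :=
            mul_le_mul_of_nonneg_left (hb.trans (le_add_of_nonneg_right zero_le_one)) (by positivity)
        _ = 1 / 2 := by field_simp
    have := neg_abs_le (ε * (R ω - Rbar))
    linarith
  -- step 3: the perturbed tilt has the same normaliser and the same `C¹` integrals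
  set g₂ : (Λ → sphere (0 : E) 1) → ℝ := fun ω =>
    -(s * S (fun m => (ω m : E))) + Real.log (1 + ε * (R ω - Rbar)) with hg₂
  have hexp2 : ∀ ω, Real.exp (g₂ ω) = w ω * (1 + ε * (R ω - Rbar)) := fun ω => by
    rw [hg₂]
    simp only
    rw [Real.exp_add, Real.exp_log (hpos ω)]
  have hg₂c : Continuous g₂ :=
    ((continuous_const.mul (hS.comp continuous_sphereConfig)).neg).add
      ((continuous_const.add (continuous_const.mul (hR.sub continuous_const))).log
        fun ω => (hpos ω).ne')
  have hexp2c : Continuous fun ω => Real.exp (g₂ ω) := Real.continuous_exp.comp hg₂c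
  have hiexp2 : Integrable (fun ω => Real.exp (g₂ ω)) μ := integrable_pi_of_continuous _ hexp2c
  have h1c : ∫ ω, w ω * 1 * (R ω - Rbar) ∂μ = 0 := h1 (fun _ => (1 : ℝ)) contDiff_const
  have hiQ : Integrable (fun ω => w ω * 1 * (R ω - Rbar)) μ :=
    integrable_pi_of_continuous _ ((hwc.mul continuous_const).mul (hR.sub continuous_const))
  have hZ2 : ∫ ω, Real.exp (g₂ ω) ∂μ = Z := by
    simp_rw [hexp2]
    have hsplit : ∀ ω, w ω * (1 + ε * (R ω - Rbar)) = w ω + ε * (w ω * 1 * (R ω - Rbar)) := by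
      intro ω; ring
    simp_rw [hsplit]
    rw [integral_add hiw (hiQ.const_mul ε), integral_const_mul, h1c, mul_zero, add_zero]
  haveI : IsProbabilityMeasure (μ.tilted g₂) := isProbabilityMeasure_tilted hiexp2
  haveI : IsProbabilityMeasure (μ.tilted fun ω => -(s * S (fun m => (ω m : E)))) :=
    isProbabilityMeasure_tilted hiw
  have hint : ∀ K : (Λ → E) → ℝ, ContDiff ℝ 1 K →
      ∫ ω, K (fun m => ((ω : Λ → sphere (0 : E) 1) m : E)) ∂μ.tilted g₂ =
        ∫ ω, K (fun m => ((ω : Λ → sphere (0 : E) 1) m : E))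
          ∂μ.tilted fun ω => -(s * S (fun m => (ω m : E))) := by
    intro K hK
    have hKc : Continuous fun ω : Λ → sphere (0 : E) 1 => K (fun m => (ω m : E)) :=
      hK.continuous.comp continuous_sphereConfig
    rw [integral_tilted, integral_tilted, hZ2]
    show ∫ x, (Real.exp (g₂ x) / Z) • K (fun m => (x m : E)) ∂μ =
      ∫ x, (w x / Z) • K (fun m => (x m : E)) ∂μ
    simp_rw [hexp2, smul_eq_mul]
    have hiA : Integrable (fun x => w x * (1 + ε * (R x - Rbar)) / Z * K (fun m => (x m : E))) μ :=
      integrable_pi_of_continuous _ (((hwc.mul (continuous_const.add (continuous_const.mul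
        (hR.sub continuous_const)))).div_const Z).mul hKc)
    have hiB : Integrable (fun x => w x / Z * K (fun m => (x m : E))) μ :=
      integrable_pi_of_continuous _ ((hwc.div_const Z).mul hKc)
    rw [← sub_eq_zero, ← integral_sub hiA hiB]
    have e : ∀ ω, w ω * (1 + ε * (R ω - Rbar)) / Z * K (fun m => (ω m : E)) -
        w ω / Z * K (fun m => (ω m : E)) = ε / Z * (w ω * K (fun m => (ω m : E)) * (R ω - Rbar)) := by
      intro ω
      field_simp
      ring
    simp_rw [e]
    rw [integral_const_mul, h1 K hK, mul_zero]
  have heq : μ.tilted g₂ = μ.tilted fun ω => -(s * S (fun m => (ω m : E))) :=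
    measure_sphereConfig_ext_of_forall_integral_contDiff_eq hint
  -- step 4: equal measures ⇒ equal densities everywhere
  have hc2 : Continuous fun x : Λ → sphere (0 : E) 1 =>
      ENNReal.ofReal (Real.exp (g₂ x) / ∫ x, Real.exp (g₂ x) ∂μ) :=
    ENNReal.continuous_ofReal.comp (hexp2c.div_const _)
  have hc1 : Continuous fun x : Λ → sphere (0 : E) 1 => ENNReal.ofReal (w x / Z) :=
    ENNReal.continuous_ofReal.comp (hwc.div_const _)
  have heq' : μ.withDensity (fun x => ENNReal.ofReal (Real.exp (g₂ x) / ∫ x, Real.exp (g₂ x) ∂μ)) =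
      μ.withDensity (fun x => ENNReal.ofReal (w x / Z)) := heq
  rw [withDensity_eq_iff_of_sigmaFinite hc2.measurable.aemeasurable hc1.measurable.aemeasurable]
    at heq'
  haveI := isOpenPosMeasure_spherePi (Λ := Λ) (E := E)
  have hfun := (Continuous.ae_eq_iff_eq μ hc2 hc1).1 heq'
  have hpt : ∀ ξ : Λ → sphere (0 : E) 1, R ξ = Rbar := fun ξ => by
    have h0 : ENNReal.ofReal (Real.exp (g₂ ξ) / ∫ x, Real.exp (g₂ x) ∂μ) = ENNReal.ofReal (w ξ / Z) :=
      congrFun hfun ξ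
    rw [hZ2, ENNReal.ofReal_eq_ofReal_iff (div_nonneg (Real.exp_pos _).le hZ.le)
      (div_nonneg (hwpos ξ).le hZ.le), hexp2, div_left_inj' hZ.ne'] at h0
    -- `w ξ * (1 + ε (R ξ − Rbar)) = w ξ`
    have h1' : ε * (R ξ - Rbar) = 0 := by
      have := mul_left_cancel₀ (hwpos ξ).ne' (h0.trans (mul_one (w ξ)).symm)
      linarith
    rcases mul_eq_zero.1 h1' with h2 | h2
    · exact absurd h2 hεpos.ne'
    · linarith
  rw [hpt ω, hpt ω']

end Cov

/-! ## §2 The flow equation is necessary -/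

section Converse

variable {G : ℝ → (Λ → E) → ℝ} {T : ℝ}

/-- **LÜSCHER'S FLOW EQUATION IS NECESSARY.**  Let `S ∈ C¹`, `G` jointly `C²` with evolution maps
`Φ = sphereTDFlow hG T`, `c` real and `|s₀| ≤ |T| + 1`.  If for EVERY `C¹` observable `H` the
tilted mean `s ↦ ⟨H∘Φ_{s→c}⟩_s` has derivative `0` at `s₀`, then the residual `𝓛_{s₀}G_{s₀} − S`
is constant on `Ω`. -/
theorem sphereLuscherL_sub_eq_of_forall_hasDerivAt_zero {S : (Λ → E) → ℝ} (hS : ContDiff ℝ 1 S)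
    (hG : ContDiff ℝ 2 fun q : ℝ × (Λ → E) => G q.1 q.2) (c : ℝ) {s₀ : ℝ} (hs₀ : |s₀| ≤ |T| + 1)
    (h : ∀ H : (Λ → E) → ℝ, ContDiff ℝ 1 H →
      HasDerivAt (fun s =>
        (∫ ω, Real.exp (-(s * S (fun m => ((ω : Λ → sphere (0 : E) 1) m : E)))) *
            H (sphereTDFlow hG T s c (fun m => (ω m : E)))
              ∂Measure.pi (fun _ : Λ => uniformSphere (volume : Measure E))) /
          ∫ ω, Real.exp (-(s * S (fun m => ((ω : Λ → sphere (0 : E) 1) m : E))))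
            ∂Measure.pi (fun _ : Λ => uniformSphere (volume : Measure E))) 0 s₀)
    (ω ω' : Λ → sphere (0 : E) 1) :
    sphereLuscherL S s₀ (G s₀) (fun m => (ω m : E)) - S (fun m => (ω m : E)) =
      sphereLuscherL S s₀ (G s₀) (fun m => (ω' m : E)) - S (fun m => (ω' m : E)) := by
  have hRc : Continuous fun ξ : Λ → sphere (0 : E) 1 =>
      sphereLuscherL S s₀ (G s₀) (fun m => (ξ m : E)) - S (fun m => (ξ m : E)) :=
    (continuous_sphereLuscherL_sphereConfig hS (contDiff_of_joint hG s₀) s₀).sub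
      (hS.continuous.comp continuous_sphereConfig)
  refine eq_of_forall_tiltedCov_eq_zero hS.continuous s₀ hRc (fun K hK => ?_) ω ω'
  -- the observable `H = K ∘ Φ_{c→s₀}` is transported back to `K`
  have hH : ContDiff ℝ 1 fun z : Λ → E => K (sphereTDFlow hG T c s₀ z) :=
    hK.comp (contDiff_sphereTDFlow_apply hG c s₀)
  have hcov := hasDerivAt_tiltedMean_comp_sphereTDFlow hS hG hH c hs₀ (T := T)
  have hzero := h _ hH
  have huniq := hcov.unique hzero
  simp only [sphereTDFlow_symm] at huniq
  exact huniq

/-- **EQUIVALENCE ON AN INTERVAL**: if the tilted means of all transported `C¹` observables are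
stationary at every `s ∈ [0, c]` (`0 ≤ c`), the generator solves Lüscher's equation there:
`𝓛_sG_s = S + C_s` on `Ω` with `C_s = (𝓛_sG_s − S)(ω₀)` — the converse of
`luscher_trivialization` (horizon `T = c`). -/
theorem sphereLuscherL_sub_eq_of_forall_hasDerivAt_zero_Icc {S : (Λ → E) → ℝ} (hS : ContDiff ℝ 1 S)
    (hG : ContDiff ℝ 2 fun q : ℝ × (Λ → E) => G q.1 q.2) {c : ℝ} (hc : 0 ≤ c)
    (h : ∀ s ∈ Icc 0 c, ∀ H : (Λ → E) → ℝ, ContDiff ℝ 1 H →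
      HasDerivAt (fun s' =>
        (∫ ω, Real.exp (-(s' * S (fun m => ((ω : Λ → sphere (0 : E) 1) m : E)))) *
            H (sphereTDFlow hG c s' c (fun m => (ω m : E)))
              ∂Measure.pi (fun _ : Λ => uniformSphere (volume : Measure E))) /
          ∫ ω, Real.exp (-(s' * S (fun m => ((ω : Λ → sphere (0 : E) 1) m : E))))
            ∂Measure.pi (fun _ : Λ => uniformSphere (volume : Measure E))) 0 s)
    (ω₀ : Λ → sphere (0 : E) 1) :
    ∀ s ∈ Icc 0 c, ∀ ω : Λ → sphere (0 : E) 1,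
      sphereLuscherL S s (G s) (fun m => (ω m : E)) = S (fun m => (ω m : E)) +
        (sphereLuscherL S s (G s) (fun m => (ω₀ m : E)) - S (fun m => (ω₀ m : E))) := by
  intro s hs ω
  have hs' : |s| ≤ |c| + 1 := by
    rw [abs_of_nonneg hs.1, abs_of_nonneg hc]; linarith [hs.2]
  have h1 := sphereLuscherL_sub_eq_of_forall_hasDerivAt_zero hS hG c hs' (h s hs) ω ω₀
  linarith

end Converse

end Summit.Ventures.LatticeQCDFlow.Exactness

end
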